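import HarnessLib

/-!
# Superseded pointer — ideator 2, crux stmt-AtomisticToContinuum-12502

This fallback copy is SUPERSEDED by `IdeatorTwoSketch.lean` in the same directory (the full sketch, with
`BridgeShape : ExpWindowDecay → RelayRaceLocality.NearConstantShortTimeHL` and `line_shape`, published once the farm's build of
`Theses/RelayRaceLocality.lean` became coherent again, 2026-08-16). Read that file; nothing lives here.
-/
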